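import Summits.QuantumFields.YangMills.Theses.ConvexGribovBody
import Summits.QuantumFields.YangMills.Theses.CertificationLength
import Summits.QuantumFields.YangMills.Theorems.OneCertifiedCubeFiniteSizeCriterion
import Summits.QuantumFields.YangMills.Theorems.ConvexGribovBodyNonSimplyConnectedLatticeGapCAFunnel
import Summits.QuantumFields.YangMills.Theorems.ConvexGribovBodyNonSimplyConnectedLatticeGapStubCruxOfBoxInfluenceDecayNSC
import Summits.QuantumFields.YangMills.Theorems.ConvexGribovBodyNonSimplyConnectedLatticeGapStubInfluenceAntitone
import Summits.QuantumFields.YangMills.Theorems.ConvexGribovBodyNonSimplyConnectedLatticeGapStubBoxInfluenceDecayOfCellAnalyticityNSC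
import HarnessLib

/-!
# `NonSimplyConnectedLatticeGap` — the weak-mixing funnel (line `Sketch` v5 of crux stmt-QuantumFields-16405,
# route `ConvexGribovBody`): weak mixing on cubes ⇒ volume-uniform torus clustering, for EVERY compact gauge group

Line `Sketch` v5 reduces the crux (volume-uniform weak-coupling time clustering of gauge-invariant local observables
on the tori `(2S+1)⁴`, compact simple `G` with `π₁(G) ≠ 0`) to WEAK MIXING ON CUBES at large `β`: for each
gauge-invariant local `A`, `|γ_{Λ_L}(A | η) − γ_{Λ_L}(A | η')| ≤ C_A e^{−mL}` on the cubes `Λ_L = [−L,L]⁴ × (4 directions)`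
of links, over all exterior data (`γ = ymSpecification ρ β`). This file lands the funnel in its natural generality and
wires it to the existing items:

* `clustering_of_boxInfluenceDecay_at` — **the core transfer at fixed `(G, ρ, β, m)`**, for EVERY compact metrisable
  group `G` and every CONTINUOUS (not necessarily faithful) representation `ρ`: weak mixing on cubes at rate `m ≥ 0`
  ⇒ `|⟨A; τ_t B⟩_{β,S}| ≤ C(A,B) e^{−mt}` on every torus `(2S+1)⁴`, `t ≤ S` (rate preserved; far-factor DLR transfer
  `FiniteSizeCriterion.abs_latticeConnectedCorr_le_of_influence` on the cube of radius `t − R_B − 1`; Georgii 2011 §8.2).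
  Non-faithful `ρ` matters for this crux: the `(G, r)`-theory is the `(G̃, r ∘ π)`-theory of the cover (K1, p126737).
* `stub_uniformLatticeGap_of_boxInfluenceDecay` (registered side-stub U of the skeleton) — the rank-0 TARGET `ConvexGribovBody.UniformLatticeGap` (all compact simple
  `G`) from weak mixing on cubes at large `β`; `nonSimplyConnectedLatticeGap_of_boxInfluenceDecayNSC` — the crux from its
  `π₁ ≠ 0` restriction (= registered stub `stub_cruxOfBoxInfluenceDecayNSC`, p127526, re-derived from the core).
* `boxInfluenceDecayNSC_of_cellAnalyticityNSC` — the old hypothesis of the line (Dobrushin–Shlosman TV finite-size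
  condition for all cell unions, = item stmt-QuantumFields-16178 restricted) implies the new one (registered stubs
  `stub_boxInfluenceDecay_of_cellAnalyticityNSC` p127812 + `stub_influence_antitone` p127590), and
  `boxInfluenceDecayNSC_of_completeAnalyticityAtLargeScales` — so does item 16178 itself
  (`CertificationLength.CompleteAnalyticityAtLargeScales`, via the landed `cellAnalyticityNSC_of_completeAnalyticityAtLargeScales`).

So the chain of certified implications is
`CompleteAnalyticityAtLargeScales (16178) ⇒ cell analyticity|¬SC ⇒ weak mixing on cubes|¬SC ⇒ NonSimplyConnectedLatticeGap`
(its composite is the already landed `nonSimplyConnectedLatticeGap_of_completeAnalyticityAtLargeScales`, not restated here),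
and the open content of the line is exactly weak mixing on cubes at large `β` — uniqueness of the infinite-volume phase
with exponential forgetting of Dirichlet boundary links by gauge-invariant local expectations — the weak-coupling problem.

References: H.-O. Georgii, *Gibbs Measures and Phase Transitions* (2011), §8.2; F. Martinelli, LNM 1717 (1999), §2.3
(weak vs. strong mixing); R. L. Dobrushin, S. B. Shlosman (1985, 1987).
-/

set_option autoImplicit false

noncomputable section

open MeasureTheory Filter
open Literature.Probability.LatticeModels
open Literature.MathematicalPhysics.QuantumLattice
open Literature.MathematicalPhysics.QuantumFieldTheory (wilsonMeasure isProbabilityMeasure_wilsonMeasure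
  latticeConnectedCorr measurable_torusLift isSpecification_ymSpecification_of_t2Space LatticeRep YMSpecies
  IsCompactSimpleLieGroup)

namespace Summit.QuantumFields.YangMills.Theorems.NonSimplyConnectedLatticeGap

/-! ## The core transfer at fixed `(G, ρ, β, m)` -/

section Core

variable {N : ℕ} {G : Type} [Group G] [TopologicalSpace G] [IsTopologicalGroup G]
  [CompactSpace G] [MeasurableSpace G] [BorelSpace G] [SecondCountableTopology G] [T2Space G]
  (ρ : G →* Matrix (Fin N) (Fin N) ℂ)

/-- **Weak mixing on cubes ⇒ volume-uniform torus clustering, rate preserved** (every compact metrisable `G`, every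
continuous representation `ρ`, every `β`, every rate `m ≥ 0`). If for every gauge-invariant local observable `A` there
is `C_A` with `|γ_{Λ_L}(A | η) − γ_{Λ_L}(A | η')| ≤ C_A e^{−mL}` for all cubes `Λ_L = [−L,L]⁴ × univ` and all exterior data,
then for all `A, B` there is `C` with `|⟨A; τ_t B⟩_{β,2S+1}| ≤ C e^{−mt}` for all `S` and all `t ≤ S`. Proof: for
`t ≥ R_A + R_B + 2` the cube of radius `L = t − R_B − 1` contains the support of `A`, injects into the torus with its
collar (`L + 1 ≤ S`) and misses the support of `τ_t B`, so `abs_latticeConnectedCorr_le_of_influence` bounds the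
correlation by `‖B‖∞ C_A e^{−mL} = ‖B‖∞ C_A e^{m(R_B+1)} e^{−mt}`; for smaller `t` use `|corr| ≤ 2‖A‖∞‖B‖∞`. -/
theorem clustering_of_boxInfluenceDecay_at (hρ : Continuous ρ) (β : ℝ) {m : ℝ} (hm : 0 ≤ m)
    (hWM : ∀ A : LocalGaugeObservable 4 G, ∃ C : ℝ, ∀ (L : ℕ) (η η' : LGConfig 4 G),
      |(∫ U, A.F U ∂(ymSpecification ρ β ((Fintype.piFinset fun _ : Fin 4 => Finset.Icc (-((L : ℕ) : ℤ)) ((L : ℕ) : ℤ)) ×ˢ (Finset.univ : Finset (Fin 4))) η)) -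
        ∫ U, A.F U ∂(ymSpecification ρ β ((Fintype.piFinset fun _ : Fin 4 => Finset.Icc (-((L : ℕ) : ℤ)) ((L : ℕ) : ℤ)) ×ˢ (Finset.univ : Finset (Fin 4))) η')| ≤ C * Real.exp (-(m * L)))
    (A B : LocalGaugeObservable 4 G) :
    ∃ C : ℝ, ∀ S t : ℕ, t ≤ S → |latticeConnectedCorr ρ β (2 * S + 1) A.F B.F t| ≤ C * Real.exp (-(m * t)) := by
  obtain ⟨CA, hCA⟩ := A.bounded
  obtain ⟨CB, hCB⟩ := B.bounded
  have hCA0 : 0 ≤ CA := (abs_nonneg _).trans (hCA fun _ => 1)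
  have hCB0 : 0 ≤ CB := (abs_nonneg _).trans (hCB fun _ => 1)
  -- the radii of the supports
  set RA : ℕ := A.supp.sup fun e => Finset.univ.sup fun i => (e.1 i).natAbs
  set RB : ℕ := B.supp.sup fun e => Finset.univ.sup fun i => (e.1 i).natAbs
  have hRA : ∀ e ∈ A.supp, ∀ i, |e.1 i| ≤ RA := fun e he i => by
    rw [Int.abs_eq_natAbs, Int.ofNat_le]
    exact (Finset.le_sup (f := fun i => (e.1 i).natAbs) (Finset.mem_univ i)).trans
      (Finset.le_sup (f := fun e : ZdEdge 4 => Finset.univ.sup fun i => (e.1 i).natAbs) he)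
  have hRB : ∀ e ∈ B.supp, ∀ i, |e.1 i| ≤ RB := fun e he i => by
    rw [Int.abs_eq_natAbs, Int.ofNat_le]
    exact (Finset.le_sup (f := fun i => (e.1 i).natAbs) (Finset.mem_univ i)).trans
      (Finset.le_sup (f := fun e : ZdEdge 4 => Finset.univ.sup fun i => (e.1 i).natAbs) he)
  clear_value RA RB
  -- the cube-influence constant of `A`
  obtain ⟨KA, hKA⟩ := hWM A
  have hKA0 : 0 ≤ KA := by
    have h1 : (0 : ℝ) ≤ KA * Real.exp (-(m * ((0 : ℕ) : ℝ))) := (abs_nonneg _).trans (hKA 0 1 1)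
    simpa using h1
  -- the constant
  refine ⟨2 * CA * CB * Real.exp (m * (RA + RB + 2)) + CB * KA * Real.exp (m * (RB + 1)), ?_⟩
  intro S t ht
  haveI := isProbabilityMeasure_wilsonMeasure (d := 4) (L := 2 * S + 1) ρ hρ β
  -- the trivial bound
  have htriv : |latticeConnectedCorr ρ β (2 * S + 1) A.F B.F t| ≤ 2 * CA * CB := by
    unfold Literature.MathematicalPhysics.QuantumFieldTheory.latticeConnectedCorr
    have h1 : |∫ U, A.F (torusLift (2 * S + 1) U) *
        B.F (Literature.MathematicalPhysics.QuantumLattice.configShift (-Pi.single 0 (t : ℤ))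
          (torusLift (2 * S + 1) U)) ∂(wilsonMeasure (d := 4) (L := 2 * S + 1) ρ β)| ≤
        CA * CB :=
      abs_integral_le_of_abs_le fun U => by
        rw [abs_mul]
        exact mul_le_mul (hCA _) (hCB _) (abs_nonneg _) hCA0
    have h2 : |∫ U, A.F (torusLift (2 * S + 1) U) ∂(wilsonMeasure (d := 4) (L := 2 * S + 1) ρ β)|
        ≤ CA := abs_integral_le_of_abs_le fun U => hCA _
    have h3 : |∫ U, B.F (torusLift (2 * S + 1) U) ∂(wilsonMeasure (d := 4) (L := 2 * S + 1) ρ β)|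
        ≤ CB := abs_integral_le_of_abs_le fun U => hCB _
    calc _ ≤ |∫ U, A.F (torusLift (2 * S + 1) U) *
          B.F (Literature.MathematicalPhysics.QuantumLattice.configShift (-Pi.single 0 (t : ℤ))
            (torusLift (2 * S + 1) U)) ∂(wilsonMeasure (d := 4) (L := 2 * S + 1) ρ β)| +
          |(∫ U, A.F (torusLift (2 * S + 1) U) ∂(wilsonMeasure (d := 4) (L := 2 * S + 1) ρ β)) *
            ∫ U, B.F (torusLift (2 * S + 1) U) ∂(wilsonMeasure (d := 4) (L := 2 * S + 1) ρ β)| :=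
          abs_sub _ _
      _ ≤ CA * CB + CA * CB := by
          rw [abs_mul]
          exact add_le_add h1 (mul_le_mul h2 h3 (abs_nonneg _) hCA0)
      _ = 2 * CA * CB := by ring
  by_cases hcase : RA + RB + 2 ≤ t
  swap
  · -- the supports are close in time: the trivial bound suffices
    have htle : (t : ℝ) ≤ RA + RB + 2 := by exact_mod_cast (not_le.1 hcase).le
    have hexp : 1 ≤ Real.exp (m * (RA + RB + 2)) * Real.exp (-(m * t)) := by
      rw [← Real.exp_add]
      refine Real.one_le_exp ?_
      have h := mul_le_mul_of_nonneg_left htle hm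
      linarith only [h]
    calc |latticeConnectedCorr ρ β (2 * S + 1) A.F B.F t| ≤ 2 * CA * CB := htriv
      _ = 2 * CA * CB * 1 + 0 := by ring
      _ ≤ 2 * CA * CB * (Real.exp (m * (RA + RB + 2)) * Real.exp (-(m * t))) +
            CB * KA * Real.exp (m * (RB + 1)) * Real.exp (-(m * t)) := by
          gcongr
          positivity
      _ = (2 * CA * CB * Real.exp (m * (RA + RB + 2)) + CB * KA * Real.exp (m * (RB + 1))) *
            Real.exp (-(m * t)) := by ring
  · -- the main case: the cube of radius `L = t - R_B - 1` with its collar fits strictly between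
    -- the support of `A` and the time-`t` translate of the support of `B`
    obtain ⟨L, hL⟩ : ∃ L : ℕ, L = t - RB - 1 := ⟨_, rfl⟩
    have hLt : L + RB + 1 = t := by omega
    have hRAL : RA + 1 ≤ L := by omega
    have hLS : L + 1 ≤ S := by omega
    -- integer forms of the separation facts
    have hI1 : (L : ℤ) + RB + 1 = t := by exact_mod_cast hLt
    have hI2 : (t : ℤ) ≤ S := by exact_mod_cast ht
    have hRAL' : (RA : ℤ) + 1 ≤ L := by exact_mod_cast hRAL
    have hLS' : (L : ℤ) + 1 ≤ S := by exact_mod_cast hLS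
    -- the cube `Λ` of radius `L`
    obtain ⟨Λ, hΛ⟩ : ∃ Λ : Finset (ZdEdge 4), Λ = (Fintype.piFinset fun _ : Fin 4 =>
      Finset.Icc (-((L : ℕ) : ℤ)) ((L : ℕ) : ℤ)) ×ˢ (Finset.univ : Finset (Fin 4)) := ⟨_, rfl⟩
    have hmemΛ : ∀ e ∈ Λ, ∀ i, -(L : ℤ) ≤ e.1 i ∧ e.1 i ≤ L := by
      intro e he i
      rw [hΛ, Finset.mem_product, Fintype.mem_piFinset] at he
      exact Finset.mem_Icc.1 (he.1 i)
    -- (i) `Λ`, the support of `A` and the collar of `Λ` inject into the torus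
    have hwide : ∀ e ∈ Λ ∪ A.supp ∪ (plaquettesTouching Λ).biUnion plaquetteEdges, ∀ i,
        -(L : ℤ) - 1 ≤ e.1 i ∧ e.1 i ≤ L + 1 := by
      intro e he i
      simp only [Finset.mem_union] at he
      rcases he with (he | he) | he
      · have h := hmemΛ e he i
        constructor <;> linarith only [h.1, h.2]
      · have h := abs_le.1 (hRA e he i)
        constructor <;> linarith only [h.1, h.2, hRAL']
      · obtain ⟨e', he', hn'⟩ := exists_near_of_mem_collar he
        have h := hmemΛ e' he' i
        have h' := hn' i
        constructor <;> linarith only [h.1, h.2, h'.1, h'.2]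
    have hinj : Set.InjOn (Torus.proj (2 * S + 1))
        ((Λ ∪ A.supp ∪ (plaquettesTouching Λ).biUnion plaquetteEdges).image Prod.fst :
          Set (Site 4)) := by
      refine (FiniteSizeCriterion.injOn_torusProj_of_width (M := 2 * S + 1) (lo := -(L : ℤ) - 1)
        (hi := (L : ℤ) + 1) (by push_cast; linarith only [hLS'])).mono fun x hx => ?_
      obtain ⟨e, he, rfl⟩ := Finset.mem_image.1 (Finset.mem_coe.1 hx)
      exact hwide e he
    -- (ii) the torus image of `Λ` misses the translate of the support of `B`
    have hfar : ∀ e ∈ B.supp.image (fun e : ZdEdge 4 => (e.1 - -Pi.single 0 (t : ℤ), e.2)),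
        ∀ e' ∈ Λ, torusEdge (2 * S + 1) e ≠ torusEdge (2 * S + 1) e' := by
      intro e he e' he' heq
      obtain ⟨e₀, he₀, rfl⟩ := Finset.mem_image.1 he
      have h0 := abs_le.1 (hRB e₀ he₀ 0)
      have h1 := hmemΛ e' he' 0
      have hproj : ((e₀.1 0 + t : ℤ) : ZMod (2 * S + 1)) = ((e'.1 0 : ℤ) : ZMod (2 * S + 1)) := by
        have h := congr_fun (congr_arg Prod.fst heq) 0
        simp only [torusEdge] at h
        simpa [Torus.proj_apply] using h
      rw [ZMod.intCast_eq_intCast_iff_dvd_sub] at hproj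
      -- `0 < (e₀.1 0 + t) - e'.1 0 < 2S+1`, contradicting divisibility
      have hpos : 0 < e₀.1 0 + t - e'.1 0 := by linarith only [h0.1, h1.2, hI1]
      have hlt' : e₀.1 0 + t - e'.1 0 < ((2 * S + 1 : ℕ) : ℤ) := by
        push_cast; linarith only [h0.2, h1.1, hI1, hI2]
      have hdvd : (((2 * S + 1 : ℕ) : ℤ)) ∣ e₀.1 0 + t - e'.1 0 := by
        have h := hproj
        rwa [← neg_sub, dvd_neg] at h
      exact absurd (Int.le_of_dvd hpos hdvd) (not_le.2 hlt')
    -- (iii) the cube-influence bound on `ℤ⁴` and the covariance bound on the torus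
    have hinfl := hKA L
    rw [← hΛ] at hinfl
    have hcov := FiniteSizeCriterion.abs_latticeConnectedCorr_le_of_influence ρ hρ β
      (M := 2 * S + 1) Λ A.measurable B.measurable hCA hCB A.isCylinder B.isCylinder t hinj hfar
      (fun η η' => hinfl η η')
    -- (iv) compare with `C e^{−m t}` using `L = t − R_B − 1`
    have hLr : (L : ℝ) + RB + 1 = t := by exact_mod_cast hLt
    have hexp : Real.exp (-(m * L)) = Real.exp (m * (RB + 1)) * Real.exp (-(m * t)) := by
      rw [← Real.exp_add, ← hLr]
      ring_nf
    calc |latticeConnectedCorr ρ β (2 * S + 1) A.F B.F t| ≤ CB * (KA * Real.exp (-(m * L))) := hcov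
      _ = 0 + CB * KA * Real.exp (m * (RB + 1)) * Real.exp (-(m * t)) := by rw [hexp]; ring
      _ ≤ 2 * CA * CB * Real.exp (m * (RA + RB + 2)) * Real.exp (-(m * t)) +
            CB * KA * Real.exp (m * (RB + 1)) * Real.exp (-(m * t)) := by
          gcongr
          positivity
      _ = (2 * CA * CB * Real.exp (m * (RA + RB + 2)) + CB * KA * Real.exp (m * (RB + 1))) *
            Real.exp (-(m * t)) := by ring

end Core

/-! ## The funnel for the target and for the crux -/

/-- **Weak mixing on cubes at large `β` ⇒ the rank-0 target `UniformLatticeGap`** (all compact simple `G`, all faithful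
unitary `r`): the hypothesis is the un-restricted form of stub `stub_boxInfluenceDecayNSC` of line `Sketch` v5; the
registered side-stub `stub_uniformLatticeGap_of_boxInfluenceDecay` of `Lines/Sketch.lean` v5; conclusion `ConvexGribovBody.UniformLatticeGap` (whose `π₁ ≠ 0` half is the crux `NonSimplyConnectedLatticeGap` and whose
`π₁ = 0` half is consumed through `BrascampLiebVacuumSC`). Core transfer + `S₁ = 0`. -/
theorem stub_uniformLatticeGap_of_boxInfluenceDecay : (∀ (G : Type) [Group G] [TopologicalSpace G] [IsTopologicalGroup G] [CompactSpace G] [MeasurableSpace G] [BorelSpace G], Literature.MathematicalPhysics.QuantumFieldTheory.IsCompactSimpleLieGroup G → ∀ r : Literature.MathematicalPhysics.QuantumFieldTheory.LatticeRep G, ∃ β₂ : ℝ, ∀ β : ℝ, β₂ ≤ β → ∃ m : ℝ, 0 < m ∧ ∀ A : Literature.MathematicalPhysics.QuantumFieldTheory.YMSpecies G, ∃ C : ℝ, ∀ (L : ℕ) (η η' : Literature.MathematicalPhysics.QuantumLattice.LGConfig 4 G), |(∫ U, A.F U ∂(Literature.MathematicalPhysics.QuantumLattice.ymSpecification r.ρ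 β ((Fintype.piFinset fun _ : Fin 4 => Finset.Icc (-((L : ℕ) : ℤ)) ((L : ℕ) : ℤ)) ×ˢ (Finset.univ : Finset (Fin 4))) η)) - ∫ U, A.F U ∂(Literature.MathematicalPhysics.QuantumLattice.ymSpecification r.ρ β ((Fintype.piFinset fun _ : Fin 4 => Finset.Icc (-((L : ℕ) : ℤ)) ((L : ℕ) : ℤ)) ×ˢ (Finset.univ : Finset (Fin 4))) η')| ≤ C * Real.exp (-(m * L))) → Summit.QuantumFields.YangMills.Theses.ConvexGribovBody.UniformLatticeGap := by
  intro h G _ _ _ _ _ _ hG r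
  obtain ⟨β₂, hβ₂⟩ := h G hG r
  refine ⟨β₂, fun β hβ => ?_⟩
  obtain ⟨m, hm, hAll⟩ := hβ₂ β hβ
  refine ⟨m, hm, 0, fun A B => ?_⟩
  haveI : T2Space G := (r.continuous.isClosedEmbedding r.injective).isEmbedding.t2Space
  haveI : SecondCountableTopology G :=
    (r.continuous.isClosedEmbedding r.injective).isEmbedding.secondCountableTopology
  obtain ⟨C, hC⟩ := clustering_of_boxInfluenceDecay_at r.ρ r.continuous β hm.le hAll A B
  exact ⟨C, fun S n _ hn => hC S n hn⟩

/-- **Weak mixing on cubes at large `β` for `π₁(G) ≠ 0` ⇒ the crux** (the registered transfer of line `Sketch` v5,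
landed as `stub_cruxOfBoxInfluenceDecayNSC`, p127526; here re-derived from the core transfer under its natural name). -/
theorem nonSimplyConnectedLatticeGap_of_boxInfluenceDecayNSC
    (h : ∀ (G : Type) [Group G] [TopologicalSpace G] [IsTopologicalGroup G] [CompactSpace G] [MeasurableSpace G] [BorelSpace G], Literature.MathematicalPhysics.QuantumFieldTheory.IsCompactSimpleLieGroup G → ¬ SimplyConnectedSpace G → ∀ r : Literature.MathematicalPhysics.QuantumFieldTheory.LatticeRep G, ∃ β₂ : ℝ, ∀ β : ℝ, β₂ ≤ β → ∃ m : ℝ, 0 < m ∧ ∀ A : Literature.MathematicalPhysics.QuantumFieldTheory.YMSpecies G, ∃ C : ℝ, ∀ (L : ℕ) (η η' : Literature.MathematicalPhysics.QuantumLattice.LGConfig 4 G), |(∫ U, A.F U ∂(Literature.MathematicalPhysics.QuantumLattice.ymSpecification r.ρ β ((Fintype.piFinset fun _ : Fin 4 => Finset.Icc (-((L : ℕ) : ℤ)) ((L : ℕ) : ℤ)) ×ˢ (Finset.univ : Finset (Fin 4))) η)) - ∫ U, A.F U ∂(Literature.MathematicalPhysics.QuantumLattice.ymSpecification r.ρ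 β ((Fintype.piFinset fun _ : Fin 4 => Finset.Icc (-((L : ℕ) : ℤ)) ((L : ℕ) : ℤ)) ×ˢ (Finset.univ : Finset (Fin 4))) η')| ≤ C * Real.exp (-(m * L))) :
    Summit.QuantumFields.YangMills.Theses.ConvexGribovBody.NonSimplyConnectedLatticeGap := by
  intro G _ _ _ _ _ _ hG hnsc r
  obtain ⟨β₂, hβ₂⟩ := h G hG hnsc r
  refine ⟨β₂, fun β hβ => ?_⟩
  obtain ⟨m, hm, hAll⟩ := hβ₂ β hβ
  refine ⟨m, hm, 0, fun A B => ?_⟩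
  haveI : T2Space G := (r.continuous.isClosedEmbedding r.injective).isEmbedding.t2Space
  haveI : SecondCountableTopology G :=
    (r.continuous.isClosedEmbedding r.injective).isEmbedding.secondCountableTopology
  obtain ⟨C, hC⟩ := clustering_of_boxInfluenceDecay_at r.ρ r.continuous β hm.le hAll A B
  exact ⟨C, fun S n _ hn => hC S n hn⟩

/-- **The old hypothesis of the line implies the new one**: the Dobrushin–Shlosman TV finite-size condition at some
`(n, ε, b)` at every `β ≥ β₂` (cell analyticity, = item stmt-QuantumFields-16178 restricted to `¬SC`) implies weak mixing
on cubes at every `β ≥ β₂` (registered stubs `stub_boxInfluenceDecay_of_cellAnalyticityNSC`, p127812, fed with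
`stub_influence_antitone`, p127590). -/
theorem boxInfluenceDecayNSC_of_cellAnalyticityNSC
    (hA : ∀ (G : Type) [Group G] [TopologicalSpace G] [IsTopologicalGroup G] [CompactSpace G] [MeasurableSpace G] [BorelSpace G], Literature.MathematicalPhysics.QuantumFieldTheory.IsCompactSimpleLieGroup G → ¬ SimplyConnectedSpace G → ∀ r : Literature.MathematicalPhysics.QuantumFieldTheory.LatticeRep G, ∃ β₂ : ℝ, ∀ β : ℝ, β₂ ≤ β → ∃ (n : ℕ) (ε : ℝ) (b : ℕ), 1 ≤ n ∧ 0 ≤ ε ∧ ε * ((((4 * n + 3) ^ 4 - (4 * n + 1) ^ 4 : ℕ)) : ℝ) < 1 ∧ 1 ≤ b ∧ (∀ w : Fin 4 → ℤ → ℤ, (∀ i j, w i j + ((b : ℕ) : ℤ) ≤ w i (j + 1) ∧ w i (j + 1) ≤ w i j + 2 * ((b : ℕ) : ℤ)) → ∀ Y : Finset (Fin 4 → ℤ), Y ⊆ (Fintype.piFinset fun _ : Fin 4 => Finset.Icc (-(2 * ((n : ℕ) : ℤ))) (2 * ((n : ℕ) : ℤ))) → (0 : Fin 4 → ℤ) ∈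 Y → ∀ η η' : Literature.MathematicalPhysics.QuantumLattice.LGConfig 4 G, (∀ e ∈ (Fintype.piFinset fun _ : Fin 4 => Finset.Icc (-(2 * ((n : ℕ) : ℤ))) (2 * ((n : ℕ) : ℤ))).biUnion (fun y : Fin 4 → ℤ => (Fintype.piFinset fun i : Fin 4 => Finset.Ico (w i (y i)) (w i (y i + 1))) ×ˢ (Finset.univ : Finset (Fin 4))), η e = η' e) → ∀ f : Literature.MathematicalPhysics.QuantumLattice.LGConfig 4 G → ℝ, Literature.MathematicalPhysics.QuantumLattice.IsCylinder f ((fun y : Fin 4 → ℤ => (Fintype.piFinset fun i : Fin 4 => Finset.Ico (w i (y i)) (w i (y i + 1))) ×ˢ (Finset.univ : Finset (Fin 4))) 0) → Measurable f → (∀ U, 0 ≤ f U ∧ f U ≤ 1) → |(∫ U, f U ∂(Literature.MathematicalPhysics.QuantumLattice.ymSpecification r.ρ β (Y.biUnion (fun y : Fin 4 → ℤ => (Fintype.piFinset fun i : Fin 4 => Finset.Ico (w i (y i)) (w i (y i + 1))) ×ˢ (Finset.univ : Finset (Fin 4)))) η)) - ∫ U, f U ∂(Literature.MathematicalPhysics.QuantumLattice.ymSpecification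 r.ρ β (Y.biUnion (fun y : Fin 4 → ℤ => (Fintype.piFinset fun i : Fin 4 => Finset.Ico (w i (y i)) (w i (y i + 1))) ×ˢ (Finset.univ : Finset (Fin 4)))) η')| ≤ ε)) :
    ∀ (G : Type) [Group G] [TopologicalSpace G] [IsTopologicalGroup G] [CompactSpace G] [MeasurableSpace G] [BorelSpace G], Literature.MathematicalPhysics.QuantumFieldTheory.IsCompactSimpleLieGroup G → ¬ SimplyConnectedSpace G → ∀ r : Literature.MathematicalPhysics.QuantumFieldTheory.LatticeRep G, ∃ β₂ : ℝ, ∀ β : ℝ, β₂ ≤ β → ∃ m : ℝ, 0 < m ∧ ∀ A : Literature.MathematicalPhysics.QuantumFieldTheory.YMSpecies G, ∃ C : ℝ, ∀ (L : ℕ) (η η' : Literature.MathematicalPhysics.QuantumLattice.LGConfig 4 G), |(∫ U, A.F U ∂(Literature.MathematicalPhysics.QuantumLattice.ymSpecification r.ρ β ((Fintype.piFinset fun _ : Fin 4 => Finset.Icc (-((L : ℕ) : ℤ)) ((L : ℕ) : ℤ)) ×ˢ (Finset.univ : Finset (Fin 4))) η)) - ∫ U, A.F U ∂(Literature.MathematicalPhysics.QuantumLattice.ymSpecification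 r.ρ β ((Fintype.piFinset fun _ : Fin 4 => Finset.Icc (-((L : ℕ) : ℤ)) ((L : ℕ) : ℤ)) ×ˢ (Finset.univ : Finset (Fin 4))) η')| ≤ C * Real.exp (-(m * L)) :=
  stub_boxInfluenceDecay_of_cellAnalyticityNSC stub_influence_antitone hA

/-- **Item stmt-QuantumFields-16178 implies the new hypothesis of the line**:
`CertificationLength.CompleteAnalyticityAtLargeScales` ⇒ cell analyticity|¬SC (landed
`cellAnalyticityNSC_of_completeAnalyticityAtLargeScales`, p123671) ⇒ weak mixing on cubes|¬SC. -/
theorem boxInfluenceDecayNSC_of_completeAnalyticityAtLargeScales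
    (h : Summit.QuantumFields.YangMills.Theses.CertificationLength.CompleteAnalyticityAtLargeScales) :
    ∀ (G : Type) [Group G] [TopologicalSpace G] [IsTopologicalGroup G] [CompactSpace G] [MeasurableSpace G] [BorelSpace G], Literature.MathematicalPhysics.QuantumFieldTheory.IsCompactSimpleLieGroup G → ¬ SimplyConnectedSpace G → ∀ r : Literature.MathematicalPhysics.QuantumFieldTheory.LatticeRep G, ∃ β₂ : ℝ, ∀ β : ℝ, β₂ ≤ β → ∃ m : ℝ, 0 < m ∧ ∀ A : Literature.MathematicalPhysics.QuantumFieldTheory.YMSpecies G, ∃ C : ℝ, ∀ (L : ℕ) (η η' : Literature.MathematicalPhysics.QuantumLattice.LGConfig 4 G), |(∫ U, A.F U ∂(Literature.MathematicalPhysics.QuantumLattice.ymSpecification r.ρ β ((Fintype.piFinset fun _ : Fin 4 => Finset.Icc (-((L : ℕ) : ℤ)) ((L : ℕ) : ℤ)) ×ˢ (Finset.univ : Finset (Fin 4))) η)) - ∫ U, A.F U ∂(Literature.MathematicalPhysics.QuantumLattice.ymSpecification r.ρ β ((Fintype.piFinset fun _ : Fin 4 => Finset.Icc (-((L : ℕ)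 : ℤ)) ((L : ℕ) : ℤ)) ×ˢ (Finset.univ : Finset (Fin 4))) η')| ≤ C * Real.exp (-(m * L)) :=
  boxInfluenceDecayNSC_of_cellAnalyticityNSC (cellAnalyticityNSC_of_completeAnalyticityAtLargeScales h)

end Summit.QuantumFields.YangMills.Theorems.NonSimplyConnectedLatticeGap

end
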